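import Summits.AtomisticToContinuum.BoseEinsteinCondensation.Theorems.BECGroundStateSOSPeriodicIRBoundTwoSectorKLSTZero
import Summits.AtomisticToContinuum.BoseEinsteinCondensation.Theorems.BECGroundStateSOSPeriodicIRBoundTwoSectorWindowTLow
import HarnessLib

/-!
# Route `BECGroundStateSOS`, crux `PeriodicIRBound` (stmt-AtomisticToContinuum-3972) — GLUE of the typed split
# `PeriodicIRBound ⟸ FloatingTwoChannelLowKLS ∧ NonIntegrablePeriodicIRBound` (lead c23, 2026-08-17; supersedes strategist s2's
# `BECGroundStateSOSPeriodicIRBoundSplit.lean`, whose child 1 was the v8 load S1' `FloatingTwoChannel`)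

Child 1 is the v9/v10 pooled load S1₀ `TwoSectorGdTransfer.FloatingTwoChannelLow` — WEAKER than s2's child 1 on three axes
(channel inequalities only on near-minimisers of total momentum zero; guard `−Aρ ≤ μ₊` instead of `0 ≤ μ₊`; the crux's own
low-momentum window `2π‖n‖_∞/L ≤ K√ρ` for every `K` instead of a fixed ball) and kernel-checked to be implied by S1', by
stmt-12620 ∧ stmt-9094 and by line 1's `C⁺ = LinearParticleHoleFloor` (Theorems/…TwoSectorLowDefs.lean,
…TwoSectorLowReduction.lean) — written over LITERATURE vocabulary only (`FloatingForLow`, `ChanPlusZero`, `ChanMinusZero`,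
`NearMinAt`, `WF.qform` unfolded; `let`-bound abbreviations `L`, `nk`, `qC`, `qA`); child 2 is S6 `NonIntegrableHalf` unfolded
(verbatim s2's). Both unfoldings are DEFINITIONAL (`Iff.rfl` below), and the glue is the landed composition
`periodicIRBound_of_floatingLow` (…TwoSectorLowDefs.lean p159540) with the landed S4₀ `stub_klsNearMinimiserTZero` (p160279) and
S5₀ `stub_windowAssemblyTLow` (p160319). The two statement texts are the `--into` children for
`ledger route edit route-AtomisticToContinuum-BECGroundStateSOS --split PeriodicIRBound --into children-low.json --glue '…'
--glue-decl-name PeriodicIRBoundOfFloatingLowSubs`; the gate's glue item `FloatingTwoChannelLowKLS → NonIntegrablePeriodicIRBound →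
PeriodicIRBound` is closed by `PeriodicIRBound_of_subsLow` (one `exact`). A prover may land this file verbatim under Theorems/.
-/

namespace Summit.AtomisticToContinuum.BoseEinsteinCondensation.Theorems.BECGroundStateSOSPeriodicIRBoundSplitLow

open Summit.AtomisticToContinuum.BoseEinsteinCondensation.Theses.BECGroundStateSOS (PeriodicIRBound)
open Summit.AtomisticToContinuum.BoseEinsteinCondensation.Cruxes.PeriodicIRBound.TwoSectorGdTransfer
  (FloatingTwoChannelLow NonIntegrableHalf periodicIRBound_of_floatingLow stub_klsNearMinimiserTZero stub_windowAssemblyTLow)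

/-- Child 1 (S1₀ `FloatingTwoChannelLow`, unfolded over Literature vocabulary) ↔ `FloatingTwoChannelLow`: definitional. [folklore] -/
theorem floatingTwoChannelLowKLS_iff :
    (∀ v : ℝ → ENNReal, Literature.MathematicalPhysics.QuantumManyBody.BoseGas.IsRepulsiveFiniteRange v → (∫⁻ x : EuclideanSpace ℝ (Fin 3), v ‖x‖) ≠ ⊤ → ∀ K : ℝ, 0 < K → ∃ ρ₀ : ℝ, 0 < ρ₀ ∧ ∃ C : ℝ, 0 < C ∧ ∃ A : ℝ, 0 ≤ A ∧ ∀ ε : ℝ, 0 < ε → ∀ ρ : ℝ, 0 < ρ → ρ < ρ₀ → ∀ᶠ m : ℕ in Filter.atTop, let L : ℝ := Literature.MathematicalPhysics.QuantumManyBody.BoseGas.sideLength ρ (m + 2); ∀ n : Fin 3 → ℤ, n ≠ 0 → 2 * Real.pi / L * ‖(fun j => (n j : ℝ))‖ ≤ K * Real.sqrt ρ → ∃ μp μm : ℝ, -(A * ρ) ≤ μp ∧ μm ≤ μp + ε * Real.sqrt (ρ * (Literature.MathematicalPhysics.QuantumManyBody.BoseGas.scatteringLength v).toReal) / L ∧ (∀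 η : ℝ, 0 < η → ∃ δ : ENNReal, 0 < δ ∧ ∀ Ψ : Literature.MathematicalPhysics.QuantumManyBody.BoseGas.PeriodicTrialState (m + 2) L, Literature.MathematicalPhysics.QuantumManyBody.BoseGas.periodicEnergy v Ψ ≤ Literature.MathematicalPhysics.QuantumManyBody.BoseGas.periodicGroundStateEnergy v (m + 2) L + δ → Literature.MathematicalPhysics.QuantumManyBody.BoseGas.HasTotalMomentum 0 Ψ.ψ → let nk : ℝ := (Literature.MathematicalPhysics.QuantumManyBody.BoseGas.cellOccupation (m + 2) L (Literature.MathematicalPhysics.QuantumManyBody.BoseGas.planeWaveMode L n) Ψ.ψ).toReal; let qC : ℝ := (∫⁻ X in Literature.MathematicalPhysics.QuantumManyBody.BoseGas.cellN (m + 2 + 1) L, (Literature.MathematicalPhysics.QuantumManyBody.BoseGas.kineticDensity (Literature.MathematicalPhysics.QuantumManyBody.BoseGas.modeCr (Literature.MathematicalPhysics.QuantumManyBody.BoseGas.planeWaveMode L n) Ψ.ψ) X + Literature.MathematicalPhysics.QuantumManyBody.BoseGas.periodicInteraction v L X * ((‖(Literature.MathematicalPhysics.QuantumManyBody.BoseGas.modeCr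 (Literature.MathematicalPhysics.QuantumManyBody.BoseGas.planeWaveMode L n) Ψ.ψ) X‖₊ : ENNReal)) ^ 2)).toReal; (nk + 1) ^ 2 ≤ (C * L ^ 2 / ‖(fun j => (n j : ℝ))‖ ^ 2) * ((1 + η) * (qC - ((Literature.MathematicalPhysics.QuantumManyBody.BoseGas.periodicGroundStateEnergy v (m + 2) L).toReal + μp) * (nk + 1)) + η * (nk + 1))) ∧ (∀ η : ℝ, 0 < η → ∃ δ : ENNReal, 0 < δ ∧ ∀ Ψ : Literature.MathematicalPhysics.QuantumManyBody.BoseGas.PeriodicTrialState (m + 2) L, Literature.MathematicalPhysics.QuantumManyBody.BoseGas.periodicEnergy v Ψ ≤ Literature.MathematicalPhysics.QuantumManyBody.BoseGas.periodicGroundStateEnergy v (m + 2) L + δ → Literature.MathematicalPhysics.QuantumManyBody.BoseGas.HasTotalMomentum 0 Ψ.ψ → let nk : ℝ := (Literature.MathematicalPhysics.QuantumManyBody.BoseGas.cellOccupation (m + 2) L (Literature.MathematicalPhysics.QuantumManyBody.BoseGas.planeWaveMode L n) Ψ.ψ).toReal; let qA : ℝ := (∫⁻ X in Literature.MathematicalPhysics.QuantumManyBody.BoseGas.cellN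 (m + 1) L, (Literature.MathematicalPhysics.QuantumManyBody.BoseGas.kineticDensity (Literature.MathematicalPhysics.QuantumManyBody.BoseGas.modeAn L (Literature.MathematicalPhysics.QuantumManyBody.BoseGas.planeWaveMode L n) Ψ.ψ) X + Literature.MathematicalPhysics.QuantumManyBody.BoseGas.periodicInteraction v L X * ((‖(Literature.MathematicalPhysics.QuantumManyBody.BoseGas.modeAn L (Literature.MathematicalPhysics.QuantumManyBody.BoseGas.planeWaveMode L n) Ψ.ψ) X‖₊ : ENNReal)) ^ 2)).toReal; nk ^ 2 ≤ (C * L ^ 2 / ‖(fun j => (n j : ℝ))‖ ^ 2) * ((1 + η) * (qA - ((Literature.MathematicalPhysics.QuantumManyBody.BoseGas.periodicGroundStateEnergy v (m + 2) L).toReal - μm) * nk) + η * nk))) ↔ FloatingTwoChannelLow :=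
  Iff.rfl

/-- Child 2 (S6, unfolded) ↔ `NonIntegrableHalf`: definitional. [folklore] -/
theorem nonIntegrablePeriodicIRBound_iff :
    (∀ v : ℝ → ENNReal, Literature.MathematicalPhysics.QuantumManyBody.BoseGas.IsRepulsiveFiniteRange v → (∫⁻ x : EuclideanSpace ℝ (Fin 3), v ‖x‖) = ⊤ → ∀ κ : ℝ, 0 < κ → ∃ ρ₀ : ℝ, 0 < ρ₀ ∧ ∃ C : ℝ, 0 < C ∧ ∀ ρ : ℝ, 0 < ρ → ρ < ρ₀ → ∀ᶠ N : ℕ in Filter.atTop, let L : ℝ := Literature.MathematicalPhysics.QuantumManyBody.BoseGas.sideLength ρ N; ∃ δ : ENNReal, 0 < δ ∧ ∀ Ψ : Literature.MathematicalPhysics.QuantumManyBody.BoseGas.PeriodicTrialState N L, Literature.MathematicalPhysics.QuantumManyBody.BoseGas.periodicEnergy v Ψ ≤ Literature.MathematicalPhysics.QuantumManyBody.BoseGas.periodicGroundStateEnergy v N L + δ → ∀ k : Fin 3 → ℤ, (k ≠ 0 ∧ ‖(fun j => (k j : ℝ))‖ ≤ κ * Real.sqrt ρ * L) → Literature.MathematicalPhysics.QuantumManyBody.BoseGas.cellOccupation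 N L (fun x => ((Real.sqrt (L ^ 3))⁻¹ : ℂ) * Literature.MathematicalPhysics.QuantumManyBody.BoseGas.cellWave L k x) Ψ.ψ ≤ ENNReal.ofReal (C * Real.sqrt ρ * L / ‖(fun j => (k j : ℝ))‖)) ↔ NonIntegrableHalf :=
  Iff.rfl

/-- **GLUE of the split `PeriodicIRBound ⟸ S1₀ ∧ S6`** (children unfolded over Literature vocabulary): the landed composition
`periodicIRBound_of_floatingLow` with the landed S4₀ p160279 and S5₀ p160319, verbatim up to `δ`/`ζ`-unfolding. [folklore] -/
theorem PeriodicIRBound_of_subsLow :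
    (∀ v : ℝ → ENNReal, Literature.MathematicalPhysics.QuantumManyBody.BoseGas.IsRepulsiveFiniteRange v → (∫⁻ x : EuclideanSpace ℝ (Fin 3), v ‖x‖) ≠ ⊤ → ∀ K : ℝ, 0 < K → ∃ ρ₀ : ℝ, 0 < ρ₀ ∧ ∃ C : ℝ, 0 < C ∧ ∃ A : ℝ, 0 ≤ A ∧ ∀ ε : ℝ, 0 < ε → ∀ ρ : ℝ, 0 < ρ → ρ < ρ₀ → ∀ᶠ m : ℕ in Filter.atTop, let L : ℝ := Literature.MathematicalPhysics.QuantumManyBody.BoseGas.sideLength ρ (m + 2); ∀ n : Fin 3 → ℤ, n ≠ 0 → 2 * Real.pi / L * ‖(fun j => (n j : ℝ))‖ ≤ K * Real.sqrt ρ → ∃ μp μm : ℝ, -(A * ρ) ≤ μp ∧ μm ≤ μp + ε * Real.sqrt (ρ * (Literature.MathematicalPhysics.QuantumManyBody.BoseGas.scatteringLength v).toReal) / L ∧ (∀ η : ℝ, 0 < η → ∃ δ : ENNReal, 0 < δ ∧ ∀ Ψ : Literature.MathematicalPhysics.QuantumManyBody.BoseGas.PeriodicTrialState (m + 2) L, Literature.MathematicalPhysics.QuantumManyBody.BoseGas.periodicEnergy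 v Ψ ≤ Literature.MathematicalPhysics.QuantumManyBody.BoseGas.periodicGroundStateEnergy v (m + 2) L + δ → Literature.MathematicalPhysics.QuantumManyBody.BoseGas.HasTotalMomentum 0 Ψ.ψ → let nk : ℝ := (Literature.MathematicalPhysics.QuantumManyBody.BoseGas.cellOccupation (m + 2) L (Literature.MathematicalPhysics.QuantumManyBody.BoseGas.planeWaveMode L n) Ψ.ψ).toReal; let qC : ℝ := (∫⁻ X in Literature.MathematicalPhysics.QuantumManyBody.BoseGas.cellN (m + 2 + 1) L, (Literature.MathematicalPhysics.QuantumManyBody.BoseGas.kineticDensity (Literature.MathematicalPhysics.QuantumManyBody.BoseGas.modeCr (Literature.MathematicalPhysics.QuantumManyBody.BoseGas.planeWaveMode L n) Ψ.ψ) X + Literature.MathematicalPhysics.QuantumManyBody.BoseGas.periodicInteraction v L X * ((‖(Literature.MathematicalPhysics.QuantumManyBody.BoseGas.modeCr (Literature.MathematicalPhysics.QuantumManyBody.BoseGas.planeWaveMode L n) Ψ.ψ) X‖₊ : ENNReal)) ^ 2)).toReal; (nk + 1) ^ 2 ≤ (C * L ^ 2 / ‖(fun j => (n j : ℝ))‖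 ^ 2) * ((1 + η) * (qC - ((Literature.MathematicalPhysics.QuantumManyBody.BoseGas.periodicGroundStateEnergy v (m + 2) L).toReal + μp) * (nk + 1)) + η * (nk + 1))) ∧ (∀ η : ℝ, 0 < η → ∃ δ : ENNReal, 0 < δ ∧ ∀ Ψ : Literature.MathematicalPhysics.QuantumManyBody.BoseGas.PeriodicTrialState (m + 2) L, Literature.MathematicalPhysics.QuantumManyBody.BoseGas.periodicEnergy v Ψ ≤ Literature.MathematicalPhysics.QuantumManyBody.BoseGas.periodicGroundStateEnergy v (m + 2) L + δ → Literature.MathematicalPhysics.QuantumManyBody.BoseGas.HasTotalMomentum 0 Ψ.ψ → let nk : ℝ := (Literature.MathematicalPhysics.QuantumManyBody.BoseGas.cellOccupation (m + 2) L (Literature.MathematicalPhysics.QuantumManyBody.BoseGas.planeWaveMode L n) Ψ.ψ).toReal; let qA : ℝ := (∫⁻ X in Literature.MathematicalPhysics.QuantumManyBody.BoseGas.cellN (m + 1) L, (Literature.MathematicalPhysics.QuantumManyBody.BoseGas.kineticDensity (Literature.MathematicalPhysics.QuantumManyBody.BoseGas.modeAn L (Literature.MathematicalPhysics.QuantumManyBody.BoseGas.planeWaveMode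 L n) Ψ.ψ) X + Literature.MathematicalPhysics.QuantumManyBody.BoseGas.periodicInteraction v L X * ((‖(Literature.MathematicalPhysics.QuantumManyBody.BoseGas.modeAn L (Literature.MathematicalPhysics.QuantumManyBody.BoseGas.planeWaveMode L n) Ψ.ψ) X‖₊ : ENNReal)) ^ 2)).toReal; nk ^ 2 ≤ (C * L ^ 2 / ‖(fun j => (n j : ℝ))‖ ^ 2) * ((1 + η) * (qA - ((Literature.MathematicalPhysics.QuantumManyBody.BoseGas.periodicGroundStateEnergy v (m + 2) L).toReal - μm) * nk) + η * nk))) →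
    (∀ v : ℝ → ENNReal, Literature.MathematicalPhysics.QuantumManyBody.BoseGas.IsRepulsiveFiniteRange v → (∫⁻ x : EuclideanSpace ℝ (Fin 3), v ‖x‖) = ⊤ → ∀ κ : ℝ, 0 < κ → ∃ ρ₀ : ℝ, 0 < ρ₀ ∧ ∃ C : ℝ, 0 < C ∧ ∀ ρ : ℝ, 0 < ρ → ρ < ρ₀ → ∀ᶠ N : ℕ in Filter.atTop, let L : ℝ := Literature.MathematicalPhysics.QuantumManyBody.BoseGas.sideLength ρ N; ∃ δ : ENNReal, 0 < δ ∧ ∀ Ψ : Literature.MathematicalPhysics.QuantumManyBody.BoseGas.PeriodicTrialState N L, Literature.MathematicalPhysics.QuantumManyBody.BoseGas.periodicEnergy v Ψ ≤ Literature.MathematicalPhysics.QuantumManyBody.BoseGas.periodicGroundStateEnergy v N L + δ → ∀ k : Fin 3 → ℤ, (k ≠ 0 ∧ ‖(fun j => (k j : ℝ))‖ ≤ κ * Real.sqrt ρ * L) → Literature.MathematicalPhysics.QuantumManyBody.BoseGas.cellOccupation N L (fun x => ((Real.sqrt (L ^ 3))⁻¹ : ℂ) * Literature.MathematicalPhysics.QuantumManyBody.BoseGas.cellWave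 L k x) Ψ.ψ ≤ ENNReal.ofReal (C * Real.sqrt ρ * L / ‖(fun j => (k j : ℝ))‖)) →
    PeriodicIRBound :=
  fun h1 h6 => periodicIRBound_of_floatingLow h1 stub_klsNearMinimiserTZero stub_windowAssemblyTLow h6

end Summit.AtomisticToContinuum.BoseEinsteinCondensation.Theorems.BECGroundStateSOSPeriodicIRBoundSplitLow
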